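import Summits.BirchSwinnertonDyer.Rank1Residual.X11a.ChainBoundedLeaves
import Summits.BirchSwinnertonDyer.Rank1Residual.X11a.ChainBySplitType
import HarnessLib

/-!
# Class X11a: the HEIGHT-FREE chain of record and its split-type forms, on the PRINT-FAITHFUL
# (BOUNDED) Wan / EPW facts (2026-08-20 repair; successors of `ChainHeightFree`, `ChainBySplitType`)

HONEST FRAMING (run/shared/lean/b2b/bsd-rank1-residual/, verbatim in every file): the goal of the
cell is to DELETE the COMBINATION-SHAPED residual classes of the Birch–Swinnerton-Dyer formula for
ALL analytic-rank `≤ 1` elliptic curves over `ℚ` — "full BSD formula for every rank `≤ 1` curve in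
class `C`" assembled STRICTLY from published theorems — so that the rank-`≤ 1` remainder becomes
exactly the CONSTRUCTION-SHAPED classes, which are TYPED (missing-input `Prop`s), NOT attempted.
This is not "finishing BSD". Research route; NO CLAIM BEYOND STATED CLASSES. Theorems only; no new
definition, no new fact; no label change (cell lead / referee).

WHY (see `X11a/ChainBounded.lean`): the chain's binders `hT2 : Wan2015.thm4_rational_weightK_member`
and `hT1b : EmertonPollackWeston2006.thm513_transfer_from_weightK_member` were mis-quantified (every
interpolant `L` with the bare predicate `IsCycPAdicLFunctionWeightK`, which `L ↦ L + log(1+T)`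
preserves while destroying boundedness — so the Wan fact is false as typed and the chain theorems
held vacuously in `hT2`; finding of the `lit-su` seat, SU2014-TYPING.md §5/§8, verified by harvest-2).
The corrected facts `…_of_bdd` (p239712 / p239784) carry the boundedness binder that
`exists_isCycPAdicLFunctionWeightK` delivers; the gate's append-only rule keeps the originals in
place (DEPRECATED, to be removed with the two retired facts once unreferenced), so the successors
live in sibling modules: `ChainBounded` (discharge + class level), this file, and its sequel.

CONTENT — successors, same statements with the two corrected binders (WEAKER hypotheses), same proofs
(the pair-level one re-runs `Chain.invariantsAt_normLam_of_facts_bdd`):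
* `bsdp_of_facts_bdd_heightFree` (← `bsdp_of_facts_heightFree`),
* `forall_bsdp_of_namedFacts_bdd_heightFree` (← `forall_bsdp_of_namedFacts_heightFree`),
* `forall_bsdp_of_namedFacts_bdd_mtt_heightFree` (← THE CHAIN OF RECORD
  `forall_bsdp_of_namedFacts_mtt_heightFree`: 14 named published facts + the per-pair certificate),
* `forall_bsdp_of_namedFacts_bdd_mtt_of_eleven_le_heightFree`, `…_bdd_mtt_of_not_dvd_heightFree`,
* `forall_bsdp_of_namedFacts_bdd_mtt_heightFree_of_nonsplit` / `…_of_split` (← `ChainBySplitType`: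
  12 named facts at a non-split `p`, 13 at a split `p`).
Class-level residue unchanged: Greenberg's `μ`-conjecture (typed `X11a.MuAnZeroAt`).

References: as in `X11a/ChainBounded.lean`, `ChainHeightFree.lean`, `ChainBySplitType.lean`.
-/

noncomputable section

open scoped Classical MatrixGroups ModularForm

open CongruenceSubgroup WeierstrassCurve Literature.NumberTheory.EllipticCurves
  Literature.NumberTheory.EllipticCurves.ModularForms
  Literature.NumberTheory.EllipticCurves.Rank1Residual
  Literature.NumberTheory.EllipticCurves.Rank1Residual.Typed
  Literature.NumberTheory.EllipticCurves.Wuthrich2014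
  Literature.NumberTheory.EllipticCurves.SteinWuthrich2013
  Literature.NumberTheory.EllipticCurves.GreenbergVatsal2000
  Literature.NumberTheory.EllipticCurves.EmertonPollackWeston2006
  Literature.NumberTheory.EllipticCurves.BalakrishnanEtAl2019
  Summit.BirchSwinnertonDyer.Rank1Residual.X1.MuLambda
  Summit.BirchSwinnertonDyer.Rank1Residual.X11a.LambdaNorm
  Summit.BirchSwinnertonDyer.Rank1Residual.RankZeroHeightFree

set_option autoImplicit false

namespace Summit.BirchSwinnertonDyer.Rank1Residual.X11a

open Chain

section EPW

variable (W : WeierstrassCurve ℚ) [W.IsElliptic] [W.IsGloballyMinimal] (p : ℕ) [Fact p.Prime]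

/-- (Successor of `bsdp_of_facts_heightFree` on the print-faithful BOUNDED Wan / EPW facts —
2026-08-20 repair; same proof.)
**`BSD(E,p)` at a pair of X11a's surjective leaf from the separate published facts** (gen 15
discharge with the existence inputs (E1)–(E3) displayed), height-free twin of `Chain.bsdp_of_facts`.
[cite: EmertonPollackWeston2006, Thm. 1, Thm. 3.1.1, Thm. 5.1.3] [cite: Wan2015, Thm. 4]
[cite: SteinWuthrich2013, Thm. 6.1 (p. 20)] -/
theorem bsdp_of_facts_bdd_heightFree [NeZero (W.conductorNorm ℤ / p)]
    (hHida : hida_exists_congruent_ordinary_newform_of_multiplicative)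
    (hMTT : exists_isCycPAdicLFunctionWeightK)
    (h311 : thm311_cotorsion_weightK_member) (hT1a : thm1_muAlg_of_weightK_member)
    (hT2 : Wan2015.thm4_rational_weightK_member_of_bdd)
    (hT1b : thm513_transfer_from_weightK_member_of_bdd)
    (hKato : kato_charIdeal_dvd_multiplicative_of_surjective)
    (hJs : thm61_splitMultiplicative) (hJn : thm61_nonsplitMultiplicative)
    (hGZK : rank_eq_analyticRank_of_analyticRank_le_one) (hmod : hasEntireLFunction_rat)
    (hpar : nonempty_modularParametrizationData)
    (hGS : greenberg_stevens (W := W) (p := p))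
    (hData : ∀ {k : ℤ} (g : CuspForm (Gamma0 (W.conductorNorm ℤ / p)) k)
      (ι : coeffField g →+* PadicAlgCl p), IsOrdinaryMemberOf W p g ι →
      Nonempty (OrdinaryPadicData g p ι))
    (hDual : ∀ {k : ℤ} (g : CuspForm (Gamma0 (W.conductorNorm ℤ / p)) k)
      (ι : coeffField g →+* PadicAlgCl p), IsOrdinaryMemberOf W p g ι →
      ∀ (𝔇 : OrdinaryPadicData g p ι) (κ : ZpExtension ℚ p)
      (γ : Field.absoluteGaloisGroup ℚ), κ.IsCyclotomic → κ.IsTopGenerator γ →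
      Nonempty (GreenbergSelmer.DualData (padicCoeffField (memberGenerators g ι 𝔇.υ)) κ γ 𝔇.ρ 𝔇.plus))
    (hGen : ∀ {k : ℤ} (g : CuspForm (Gamma0 (W.conductorNorm ℤ / p)) k)
      (ι : coeffField g →+* PadicAlgCl p), IsOrdinaryMemberOf W p g ι →
      ∀ (𝔇 : OrdinaryPadicData g p ι) (κ : ZpExtension ℚ p)
      (γ : Field.absoluteGaloisGroup ℚ), κ.IsCyclotomic → κ.IsTopGenerator γ →
      ∀ (D : GreenbergSelmer.DualData (padicCoeffField (memberGenerators g ι 𝔇.υ)) κ γ 𝔇.ρ 𝔇.plus),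
      Module.Finite (PowerSeries (padicCoeffIntegers (memberGenerators g ι 𝔇.υ))) D.X →
      Module.IsTorsion (PowerSeries (padicCoeffIntegers (memberGenerators g ι 𝔇.υ))) D.X →
      ∃ G, D.charIdeal = Ideal.span {G})
    (hp : 5 ≤ p) (hmult : W.HasMultiplicativeReductionAtPrime p)
    (hsurj : W.HasSurjectiveModNGaloisRep p) (hr : W.analyticRank = 0) (hμ : MuAnZeroAt W p) :
    BSDp W p :=
  bsdp_of_invariantsMatchAt_heightFree W p hKato hJs hJn hGZK hmod hpar hGS hp hmult hsurj hr
    (invariantsMatchAt_of_invariantsAt_normLam W p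
      (invariantsAt_normLam_of_facts_bdd W p hHida hMTT h311 hT1a hT2 hT1b hKato hpar hData hDual hGen hp
        hmult hsurj hμ))

end EPW

/-- (Successor of `forall_bsdp_of_namedFacts_heightFree` on the print-faithful BOUNDED Wan / EPW facts —
2026-08-20 repair; same proof.)
**X11a ∩ {`p ≥ 5`, `ρ̄_{E,p}` surjective}: `BSD(E,p)` ⇐ NAMED PUBLISHED FACTS (incl. the MTT
existence fact `hMTT`) + the per-pair certificate**, height-free twin of `forall_bsdp_of_namedFacts_bdd`
(the existence inputs (E1)–(E3) being the harvest-2 theorems, as there).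
[cite: EmertonPollackWeston2006, Thm. 1, Thm. 3.1.1, Thm. 5.1.3, §3.1] [cite: Wan2015, Thm. 4]
[cite: SteinWuthrich2013, Thm. 6.1 (p. 20)] [cite: Wuthrich2014, Thm. 3 (p. 382) and Cor. 19 proof (p. 399)] -/
theorem forall_bsdp_of_namedFacts_bdd_heightFree
    (hHida : hida_exists_congruent_ordinary_newform_of_multiplicative)
    (hMTT : exists_isCycPAdicLFunctionWeightK)
    (h311 : thm311_cotorsion_weightK_member) (hT1a : thm1_muAlg_of_weightK_member)
    (hT2 : Wan2015.thm4_rational_weightK_member_of_bdd)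
    (hT1b : thm513_transfer_from_weightK_member_of_bdd)
    (h61 : DeligneSerre1974.thm61_exists_adicGaloisRep) (h326 : Hida2000_thm326_ordinary)
    (hKato : kato_charIdeal_dvd_multiplicative_of_surjective)
    (hJs : thm61_splitMultiplicative) (hJn : thm61_nonsplitMultiplicative)
    (hGZK : rank_eq_analyticRank_of_analyticRank_le_one) (hmod : hasEntireLFunction_rat)
    (hpar : nonempty_modularParametrizationData)
    (hGS : ∀ (W : WeierstrassCurve ℚ) [W.IsElliptic] [W.IsGloballyMinimal] (p : ℕ) [Fact p.Prime],
      greenberg_stevens (W := W) (p := p)) :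
    ∀ (W : WeierstrassCurve ℚ) [W.IsElliptic] [W.IsGloballyMinimal] (p : ℕ) [Fact p.Prime],
      ClassX11a W p → 5 ≤ p → Surj W p → MuAnZeroAt W p → BSDp W p := by
  intro W _ _ p _ hX hp hsurj hμ
  haveI : NeZero (W.conductorNorm ℤ / p) := neZero_conductorNorm_div W p hX.2.2.1
  haveI : NeZero p := ⟨(Fact.out : p.Prime).ne_zero⟩
  have hmult : W.HasMultiplicativeReductionAtPrime p := hX.2.2.1
  have hirr : W.HasIrreducibleModPGaloisRep p :=
    hasIrreducibleModPGaloisRep_of_hasSurjectiveModNGaloisRep W p hsurj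
  exact bsdp_of_facts_bdd_heightFree W p hHida hMTT h311 hT1a hT2 hT1b hKato hJs hJn hGZK hmod hpar
    (hGS W p)
    (fun g ι hmem =>
      exists_ordinaryPadicData_weightK_member_of_thm61_of_thm326 h61 h326 W p hp hmult hirr g ι hmem)
    (fun g ι hmem 𝔇 κ γ hκ hγ =>
      GreenbergSelmer.exists_dualData_weightK_member_unconditional W p hp hmult hirr g ι hmem 𝔇 κ γ
        hκ hγ)
    (fun g ι hmem 𝔇 κ γ hκ hγ D hfin htors =>
      (charIdeal_isPrincipal_weightK_member_unconditional W p hp hmult hirr g ι hmem 𝔇 κ γ hκ hγ D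
        hfin htors).principal)
    hp hmult hsurj hX.1 hμ

/-- (Successor of `forall_bsdp_of_namedFacts_mtt_heightFree` on the print-faithful BOUNDED Wan / EPW facts —
2026-08-20 repair; same proof.)
**THE CHAIN OF RECORD — X11a ∩ {`p ≥ 5`, `ρ̄_{E,p}` surjective}: `BSD(E,p)` ⇐ 14 NAMED
PUBLISHED FACTS + the per-pair certificate `μ^an(E,p) = 0`.** The 14: Hida's congruent ordinary
member (`hHida`), EPW 2006 Thm 3.1.1 / Thm 1 / Thm 5.1.3 (`h311`, `hT1a`, `hT1b`), Wan 2015 Thm 4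
rational (`hT2`), Deligne–Serre 6.1 (`h61`), Hida/Wiles 3.26 (`h326`), Kato–Wuthrich A32 (`hKato`),
Stein–Wuthrich 2013 Thm 6.1 split / non-split (`hJs`, `hJn`), Gross–Zagier–Kolyvagin (`hGZK`),
modularity (`hmod`, `hpar`), Greenberg–Stevens (`hGS`).  Versus `forall_bsdp_of_namedFacts_bdd_mtt`
(16): the Stein–Wuthrich height-existence facts are discharged (zero datum at rank `0`).  Class-level
residue unchanged: Greenberg's `μ`-conjecture (typed `X11a.MuAnZeroAt`).  No label change.
[cite: MazurTateTeitelbaum1986Invent, §I.11 and §I.14 (14.3)]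
[cite: EmertonPollackWeston2006, Thm. 1, Thm. 3.1.1, Thm. 5.1.3, §3.1] [cite: Wan2015, Thm. 4]
[cite: SteinWuthrich2013, Thm. 6.1 (p. 20) and §4.2] [cite: Wuthrich2014, Thm. 3 (p. 382) and Cor. 19 proof (p. 399)] -/
theorem forall_bsdp_of_namedFacts_bdd_mtt_heightFree
    (hHida : hida_exists_congruent_ordinary_newform_of_multiplicative)
    (h311 : thm311_cotorsion_weightK_member) (hT1a : thm1_muAlg_of_weightK_member)
    (hT2 : Wan2015.thm4_rational_weightK_member_of_bdd)
    (hT1b : thm513_transfer_from_weightK_member_of_bdd)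
    (h61 : DeligneSerre1974.thm61_exists_adicGaloisRep) (h326 : Hida2000_thm326_ordinary)
    (hKato : kato_charIdeal_dvd_multiplicative_of_surjective)
    (hJs : thm61_splitMultiplicative) (hJn : thm61_nonsplitMultiplicative)
    (hGZK : rank_eq_analyticRank_of_analyticRank_le_one) (hmod : hasEntireLFunction_rat)
    (hpar : nonempty_modularParametrizationData)
    (hGS : ∀ (W : WeierstrassCurve ℚ) [W.IsElliptic] [W.IsGloballyMinimal] (p : ℕ) [Fact p.Prime],
      greenberg_stevens (W := W) (p := p)) :
    ∀ (W : WeierstrassCurve ℚ) [W.IsElliptic] [W.IsGloballyMinimal] (p : ℕ) [Fact p.Prime],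
      ClassX11a W p → 5 ≤ p → Surj W p → MuAnZeroAt W p → BSDp W p :=
  forall_bsdp_of_namedFacts_bdd_heightFree hHida exists_isCycPAdicLFunctionWeightK_holds h311 hT1a hT2 hT1b
    h61 h326 hKato hJs hJn hGZK hmod hpar hGS

/-- (Successor of `forall_bsdp_of_namedFacts_mtt_of_eleven_le_heightFree` on the print-faithful BOUNDED Wan / EPW facts —
2026-08-20 repair; same proof.)
**X11a ∩ {`p ≥ 11`}: `BSD(E,p)` ⇐ 15 NAMED PUBLISHED FACTS + the per-pair certificate, with NO
hypothesis on the image of `ρ̄_{E,p}`** (`Surj` from BDMTV 2019 Thm. 1.2, `hB`, via x11c's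
`ClassX11a.surj_of_eleven_le`), height-free twin of `forall_bsdp_of_namedFacts_bdd_mtt_of_eleven_le`.
[cite: BalakrishnanEtAl2019, §1 Thm. 1.2 (arXiv:1711.05846 p. 2)]
[cite: MazurTateTeitelbaum1986Invent, §I.11 and §I.14 (14.3)] [cite: SteinWuthrich2013, Thm. 6.1 (p. 20) and §4.2] -/
theorem forall_bsdp_of_namedFacts_bdd_mtt_of_eleven_le_heightFree
    (hHida : hida_exists_congruent_ordinary_newform_of_multiplicative)
    (h311 : thm311_cotorsion_weightK_member) (hT1a : thm1_muAlg_of_weightK_member)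
    (hT2 : Wan2015.thm4_rational_weightK_member_of_bdd)
    (hT1b : thm513_transfer_from_weightK_member_of_bdd)
    (h61 : DeligneSerre1974.thm61_exists_adicGaloisRep) (h326 : Hida2000_thm326_ordinary)
    (hKato : kato_charIdeal_dvd_multiplicative_of_surjective)
    (hJs : thm61_splitMultiplicative) (hJn : thm61_nonsplitMultiplicative)
    (hGZK : rank_eq_analyticRank_of_analyticRank_le_one) (hmod : hasEntireLFunction_rat)
    (hpar : nonempty_modularParametrizationData)
    (hGS : ∀ (W : WeierstrassCurve ℚ) [W.IsElliptic] [W.IsGloballyMinimal] (p : ℕ) [Fact p.Prime],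
      greenberg_stevens (W := W) (p := p))
    (hB : thm12_not_le_normalizer_splitCartan) :
    ∀ (W : WeierstrassCurve ℚ) [W.IsElliptic] [W.IsGloballyMinimal] (p : ℕ) [Fact p.Prime],
      ClassX11a W p → 11 ≤ p → MuAnZeroAt W p → BSDp W p := by
  intro W _ _ p _ hX h11 hμ
  exact forall_bsdp_of_namedFacts_bdd_mtt_heightFree hHida h311 hT1a hT2 hT1b h61 h326 hKato hJs hJn hGZK
    hmod hpar hGS W p hX (by omega) (ClassX11a.surj_of_eleven_le W p hB hX h11) hμ

/-- (Successor of `forall_bsdp_of_namedFacts_mtt_of_not_dvd_heightFree` on the print-faithful BOUNDED Wan / EPW facts —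
2026-08-20 repair; same proof.)
**X11a ∩ {`p ≥ 5`, `p ∤ ord_p(Δ_min)`}: `BSD(E,p)` ⇐ 14 NAMED PUBLISHED FACTS + the per-pair
certificate, with NO hypothesis on the image of `ρ̄_{E,p}` and no extra named fact** (`Surj` from
the integer check, x11c's `ClassX11a.surj_of_not_dvd`), height-free twin of
`forall_bsdp_of_namedFacts_bdd_mtt_of_not_dvd`. [cite: SerreInventiones1972, §1.12 (Cor. of Prop. 13), §2.4 Prop. 15]
[cite: MazurTateTeitelbaum1986Invent, §I.11 and §I.14 (14.3)] [cite: SteinWuthrich2013, Thm. 6.1 (p. 20) and §4.2] -/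
theorem forall_bsdp_of_namedFacts_bdd_mtt_of_not_dvd_heightFree
    (hHida : hida_exists_congruent_ordinary_newform_of_multiplicative)
    (h311 : thm311_cotorsion_weightK_member) (hT1a : thm1_muAlg_of_weightK_member)
    (hT2 : Wan2015.thm4_rational_weightK_member_of_bdd)
    (hT1b : thm513_transfer_from_weightK_member_of_bdd)
    (h61 : DeligneSerre1974.thm61_exists_adicGaloisRep) (h326 : Hida2000_thm326_ordinary)
    (hKato : kato_charIdeal_dvd_multiplicative_of_surjective)
    (hJs : thm61_splitMultiplicative) (hJn : thm61_nonsplitMultiplicative)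
    (hGZK : rank_eq_analyticRank_of_analyticRank_le_one) (hmod : hasEntireLFunction_rat)
    (hpar : nonempty_modularParametrizationData)
    (hGS : ∀ (W : WeierstrassCurve ℚ) [W.IsElliptic] [W.IsGloballyMinimal] (p : ℕ) [Fact p.Prime],
      greenberg_stevens (W := W) (p := p)) :
    ∀ (W : WeierstrassCurve ℚ) [W.IsElliptic] [W.IsGloballyMinimal] (p : ℕ) [Fact p.Prime],
      ClassX11a W p → 5 ≤ p → ¬ p ∣ padicValInt p W.minimalDiscriminantInt →
        MuAnZeroAt W p → BSDp W p := by
  intro W _ _ p _ hX h5 hn hμ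
  exact forall_bsdp_of_namedFacts_bdd_mtt_heightFree hHida h311 hT1a hT2 hT1b h61 h326 hKato hJs hJn hGZK
    hmod hpar hGS W p hX h5 (ClassX11a.surj_of_not_dvd W p hX hn) hμ

/-- (Successor of `forall_bsdp_of_namedFacts_mtt_heightFree_of_nonsplit` on the print-faithful BOUNDED Wan / EPW facts —
2026-08-20 repair; same proof.)
**X11a ∩ {`p ≥ 5`, `ρ̄_{E,p}` surjective, `p` NON-split}: `BSD(E,p)` ⇐ 12 NAMED PUBLISHED FACTS
+ the per-pair certificate `μ^an(E,p) = 0`.** The 12: Hida's member (`hHida`), EPW Thm 3.1.1 / 1 /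
5.1.3 (`h311`, `hT1a`, `hT1b`), Wan Thm 4 rational (`hT2`), Deligne–Serre 6.1 (`h61`), Hida/Wiles
3.26 (`h326`), Kato–Wuthrich A32 (`hKato`), Stein–Wuthrich Thm 6.1 NON-split (`hJn`), GZK (`hGZK`),
modularity (`hmod`, `hpar`). Greenberg–Stevens is vacuous here (`greenberg_stevens_of_not_split`);
the existence inputs (E1)–(E3) are the harvest-2 theorems as in `forall_bsdp_of_namedFacts_bdd`; the
MTT existence fact is the tree theorem `exists_isCycPAdicLFunctionWeightK_holds`. No label change.
[cite: EmertonPollackWeston2006, Thm. 1, Thm. 3.1.1, Thm. 5.1.3, §3.1] [cite: Wan2015, Thm. 4]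
[cite: SteinWuthrich2013, Thm. 6.1 (p. 20) and §4.2 (p. 15)]
[cite: Wuthrich2014, Thm. 3 (p. 382) and Cor. 19 proof (p. 399)] -/
theorem forall_bsdp_of_namedFacts_bdd_mtt_heightFree_of_nonsplit
    (hHida : hida_exists_congruent_ordinary_newform_of_multiplicative)
    (h311 : thm311_cotorsion_weightK_member) (hT1a : thm1_muAlg_of_weightK_member)
    (hT2 : Wan2015.thm4_rational_weightK_member_of_bdd)
    (hT1b : thm513_transfer_from_weightK_member_of_bdd)
    (h61 : DeligneSerre1974.thm61_exists_adicGaloisRep) (h326 : Hida2000_thm326_ordinary)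
    (hKato : kato_charIdeal_dvd_multiplicative_of_surjective)
    (hJn : thm61_nonsplitMultiplicative)
    (hGZK : rank_eq_analyticRank_of_analyticRank_le_one) (hmod : hasEntireLFunction_rat)
    (hpar : nonempty_modularParametrizationData) :
    ∀ (W : WeierstrassCurve ℚ) [W.IsElliptic] [W.IsGloballyMinimal] (p : ℕ) [Fact p.Prime],
      ClassX11a W p → 5 ≤ p → Surj W p → ¬ W.HasSplitMultiplicativeReductionAtPrime p →
        MuAnZeroAt W p → BSDp W p := by
  intro W _ _ p _ hX hp hsurj hns hμ
  haveI : NeZero (W.conductorNorm ℤ / p) := neZero_conductorNorm_div W p hX.2.2.1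
  haveI : NeZero p := ⟨(Fact.out : p.Prime).ne_zero⟩
  have hmult : W.HasMultiplicativeReductionAtPrime p := hX.2.2.1
  have hirr : W.HasIrreducibleModPGaloisRep p :=
    hasIrreducibleModPGaloisRep_of_hasSurjectiveModNGaloisRep W p hsurj
  have hGS : greenberg_stevens (W := W) (p := p) :=
    RankZeroHeightFree.greenberg_stevens_of_not_split W p hns
  have hinv : InvariantsMatchAt W p :=
    invariantsMatchAt_of_invariantsAt_normLam W p
      (invariantsAt_normLam_of_facts_bdd W p hHida exists_isCycPAdicLFunctionWeightK_holds h311 hT1a hT2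
        hT1b hKato hpar
        (fun g ι hmem =>
          exists_ordinaryPadicData_weightK_member_of_thm61_of_thm326 h61 h326 W p hp hmult hirr g ι
            hmem)
        (fun g ι hmem 𝔇 κ γ hκ hγ =>
          GreenbergSelmer.exists_dualData_weightK_member_unconditional W p hp hmult hirr g ι hmem 𝔇
            κ γ hκ hγ)
        (fun g ι hmem 𝔇 κ γ hκ hγ D hfin htors =>
          (charIdeal_isPrincipal_weightK_member_unconditional W p hp hmult hirr g ι hmem 𝔇 κ γ hκ
            hγ D hfin htors).principal)
        hp hmult hsurj hμ)
  exact X2.bsdp_of_mazurMainConjectureAt_of_analyticRank_eq_zero_heightFree_nonsplit hJn hGZK hmod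
    hpar W p (by omega) hmult hns hX.1
    (mazurMainConjectureAt_of_invariantsMatchAt hKato hmod W p hGS hp hmult hsurj hX.1 hinv)

/-- (Successor of `forall_bsdp_of_namedFacts_mtt_heightFree_of_split` on the print-faithful BOUNDED Wan / EPW facts —
2026-08-20 repair; same proof.)
**X11a ∩ {`p ≥ 5`, `ρ̄_{E,p}` surjective, `p` SPLIT}: `BSD(E,p)` ⇐ 13 NAMED PUBLISHED FACTS +
the per-pair certificate** — the 12 of the non-split case with Stein–Wuthrich Thm 6.1 SPLIT
(`hJs`) in place of non-split, plus Greenberg–Stevens (`hGS`, needed: the trivial zero).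
No label change. [cite: EmertonPollackWeston2006, Thm. 1, Thm. 3.1.1, Thm. 5.1.3, §3.1]
[cite: Wan2015, Thm. 4] [cite: SteinWuthrich2013, Thm. 6.1 (p. 20) and §4.2 (p. 16)]
[cite: Kobayashi2006DocMath, Cor. 4.2 (p. 575)] [cite: Wuthrich2014, Thm. 3 (p. 382) and Cor. 19 proof (p. 399)] -/
theorem forall_bsdp_of_namedFacts_bdd_mtt_heightFree_of_split
    (hHida : hida_exists_congruent_ordinary_newform_of_multiplicative)
    (h311 : thm311_cotorsion_weightK_member) (hT1a : thm1_muAlg_of_weightK_member)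
    (hT2 : Wan2015.thm4_rational_weightK_member_of_bdd)
    (hT1b : thm513_transfer_from_weightK_member_of_bdd)
    (h61 : DeligneSerre1974.thm61_exists_adicGaloisRep) (h326 : Hida2000_thm326_ordinary)
    (hKato : kato_charIdeal_dvd_multiplicative_of_surjective)
    (hJs : thm61_splitMultiplicative)
    (hGZK : rank_eq_analyticRank_of_analyticRank_le_one) (hmod : hasEntireLFunction_rat)
    (hpar : nonempty_modularParametrizationData)
    (hGS : ∀ (W : WeierstrassCurve ℚ) [W.IsElliptic] [W.IsGloballyMinimal] (p : ℕ) [Fact p.Prime],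
      greenberg_stevens (W := W) (p := p)) :
    ∀ (W : WeierstrassCurve ℚ) [W.IsElliptic] [W.IsGloballyMinimal] (p : ℕ) [Fact p.Prime],
      ClassX11a W p → 5 ≤ p → Surj W p → W.HasSplitMultiplicativeReductionAtPrime p →
        MuAnZeroAt W p → BSDp W p := by
  intro W _ _ p _ hX hp hsurj hsplit hμ
  haveI : NeZero (W.conductorNorm ℤ / p) := neZero_conductorNorm_div W p hX.2.2.1
  haveI : NeZero p := ⟨(Fact.out : p.Prime).ne_zero⟩
  have hmult : W.HasMultiplicativeReductionAtPrime p := hX.2.2.1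
  have hirr : W.HasIrreducibleModPGaloisRep p :=
    hasIrreducibleModPGaloisRep_of_hasSurjectiveModNGaloisRep W p hsurj
  have hinv : InvariantsMatchAt W p :=
    invariantsMatchAt_of_invariantsAt_normLam W p
      (invariantsAt_normLam_of_facts_bdd W p hHida exists_isCycPAdicLFunctionWeightK_holds h311 hT1a hT2
        hT1b hKato hpar
        (fun g ι hmem =>
          exists_ordinaryPadicData_weightK_member_of_thm61_of_thm326 h61 h326 W p hp hmult hirr g ι
            hmem)
        (fun g ι hmem 𝔇 κ γ hκ hγ =>
          GreenbergSelmer.exists_dualData_weightK_member_unconditional W p hp hmult hirr g ι hmem 𝔇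
            κ γ hκ hγ)
        (fun g ι hmem 𝔇 κ γ hκ hγ D hfin htors =>
          (charIdeal_isPrincipal_weightK_member_unconditional W p hp hmult hirr g ι hmem 𝔇 κ γ hκ
            hγ D hfin htors).principal)
        hp hmult hsurj hμ)
  exact X2.bsdp_of_mazurMainConjectureAt_of_analyticRank_eq_zero_heightFree_split hJs hGZK hmod hpar
    W p (hGS W p) (by omega) hsplit hX.1
    (mazurMainConjectureAt_of_invariantsMatchAt hKato hmod W p (hGS W p) hp hmult hsurj hX.1 hinv)

end Summit.BirchSwinnertonDyer.Rank1Residual.X11a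

end
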